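import Summits.BirchSwinnertonDyer.BirchSwinnertonDyer.Theorems.KolyvaginDepthDoorDepthTableKuriharaRow389a1
import Summits.BirchSwinnertonDyer.BirchSwinnertonDyer.Theorems.KolyvaginDepthDoorDepthTableJLSRows
import HarnessLib

/-!
# Route `KolyvaginDepthDoor`, crux `KolyvaginDepthSupplyKN` (stmt-BirchSwinnertonDyer-22820) —
# DEPTH TABLE v17, ROW `389a1` IN THE KURIHARA CURRENCY AT `p = 11` AND `p = 13` (`d_K = −7`): the crux's clause at
# `389a1` modulo print and two in-tree Kurihara certificates, at two MORE admissible primes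

Helper file of the lead prover of line `levelone` (kdd-p1 g21; `--supports stmt-BirchSwinnertonDyer-22820
--as helper`); it closes nothing and BSD is NOT proved by it.

Sequel of `KolyvaginDepthDoorDepthTableKuriharaRow389a1` (the `p`-uniform shape `C389a1.cruxBody_of_kuriharaClaims_neg7_at`
and the `p = 5` instance). The tree's Kurihara records for `389a1` and for its Heegner twist `19061a1 = 389a1^{(−7)}`
exist at THREE common primes: `cert_389a1` = `(5, 41·61, 2, 2)`, `(11, 397·991, 2, 6)`, `(13, 131·911, 2, 3)` and
`cert_19061a1` = `(5, 211, 1, 3)`, `(11, 199, 1, 8)`, `(13, 911, 1, 6)` (files `KuriharaCertificates/RecordsN000352to000389`,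
`RecordsN019053to019073`; job `j034590`). This file instantiates the row at `p = 11` and `p = 13`; every side
condition is decided in the kernel: `a_11(E) = −4`, `a_13(E) = −3` (good ordinary, non-anomalous), `ρ̄_{E,11}`,
`ρ̄_{E,13}` onto (semistable + Mazur's Frobenius no-root witnesses `a_7 = −5` mod `11`, `a_3 = −2` mod `13`; Serre
Prop. 21), the levels `397, 991 ∈ 𝒫₁(E, 11)`, `131, 911 ∈ 𝒫₁(E, 13)`, `199 ∈ 𝒫₁(T₀, 11)`, `911 ∈ 𝒫₁(T₀, 13)`
with cyclic `p`-parts (`#Ẽ(𝔽₃₉₇) = 374 = 11·34`, `#Ẽ(𝔽₉₉₁) = 1045 = 11·95`, `#Ẽ(𝔽₁₃₁) = 130`, `#Ẽ(𝔽₉₁₁) = 936 = 13·72`,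
`#T̃₀(𝔽₁₉₉) = 198 = 11·18`, `#T̃₀(𝔽₉₁₁) = 936`), `a_11(T₀) = −4`, `a_13(T₀) = 3` (non-anomalous). `11` SPLITS and
`13` is INERT in `ℚ(√−7)`: W. Zhang's ♠ supply serves both.

RESULT (`C389a1.cruxBody_of_kuriharaClaims_11_neg7`, `…_13_neg7`): for EVERY imaginary quadratic `K` with `d_K = −7`,
the clause of `KolyvaginDepthSupplyKN` at `389a1` with witness prime `11`, resp. `13`, CONDITIONAL on Kim 2026 Thm.
1.11, modularity, Mazur 1978 Cor. 4.1, W. Zhang 2014 L8.4 (1)/9.1 BY NAME and the two record claims at that prime.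
Reading: the v17 row of `389a1` is CLOSED at three admissible primes by certificates already in the tree — the
depth door's datum at `(389a1, p, ℚ(√−7))` for `p ∈ {5, 11, 13}` is two cyclotomic Kurihara bits, both in hand.
Per curve; nothing class-wide; BSD is NOT proved by it.

References: [Kim2022StructureSelmer] Thm. 1.11, §1.2.2; [WZhang2014] Lemma 8.4 (1), Thm. 9.1; [Mazur1978] Cor. 4.1,
Prop. 6.3 (1); [Serre1972] §5.4 Prop. 21; [CremonaAlgorithms1997] Table 1 (389a1); [SilvermanAEC2009] VII.3.1.
-/

set_option linter.dupNamespace false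

noncomputable section

open scoped Classical NumberField

namespace Summit.BirchSwinnertonDyer.BirchSwinnertonDyer.Theorems.KolyvaginDepthDoor

open Literature.NumberTheory.EllipticCurves Literature.NumberTheory.EllipticCurves.ModularForms
  WeierstrassCurve NumberField IsDedekindDomain
open Summit.BirchSwinnertonDyer.BirchSwinnertonDyer.Theorems
open Summit.BirchSwinnertonDyer.BirchSwinnertonDyer.Rank2Observatory
open Summit.BirchSwinnertonDyer.BirchSwinnertonDyer.Rank1Residual (IntModel.frobeniusTrace_eq)
open Summit.BirchSwinnertonDyer.Rank1Residual.Supersingular (natCard_point_eq_of_countPoints countPoints_eq_of_fast)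
open Summit.BirchSwinnertonDyer.Rank1Residual.Additive (card_torsion_le_of_intModel_of_card
  isKolyvaginPrime_of_intModel_of_card isKolyvaginProduct_mul)

namespace C389a1

/-! ## Kernel point counts of `E = 389a1 = [0,1,1,−2,0]` and `T₀ = [0,−1,1,−114,−302]` (`countPointsFast`) -/

/-- `#Ẽ(𝔽₇) = 13` (`a_7 = −5`; irreducibility witness at `p = 11`). [cite: CremonaAlgorithms1997, Table 1 (389a1)] -/
theorem card_7 :
    Nat.card (((⟨0, 1, 1, -2, 0⟩ : WeierstrassCurve ℤ).map (Int.castRingHom (ZMod 7))).toAffine.Point) = 13 :=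
  haveI : Fact (Nat.Prime 7) := ⟨by norm_num⟩
  natCard_point_eq_of_countPoints 0 1 1 (-2) 0 7 (by norm_num) (by decide +kernel) (n := 13)
    (countPoints_eq_of_fast (by decide +kernel))

/-- `#Ẽ(𝔽₁₃) = 17` (`a_13 = −3`: good ordinary, non-anomalous at `13`). [cite: CremonaAlgorithms1997, Table 1 (389a1)] -/
theorem card_13 :
    Nat.card (((⟨0, 1, 1, -2, 0⟩ : WeierstrassCurve ℤ).map (Int.castRingHom (ZMod 13))).toAffine.Point) = 17 :=
  haveI : Fact (Nat.Prime 13) := ⟨by norm_num⟩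
  natCard_point_eq_of_countPoints 0 1 1 (-2) 0 13 (by norm_num) (by decide +kernel) (n := 17)
    (countPoints_eq_of_fast (by decide +kernel))

/-- `#Ẽ(𝔽₁₃₁) = 130 = 13·10` (`131 ≡ 1`, `a_131 = 2 ≡ 2 (mod 13)`; cyclic `13`-part). [cite: Kim2022StructureSelmer, §1.2.2 (PDF p. 5)] -/
theorem card_131 :
    Nat.card (((⟨0, 1, 1, -2, 0⟩ : WeierstrassCurve ℤ).map (Int.castRingHom (ZMod 131))).toAffine.Point) = 130 :=
  haveI : Fact (Nat.Prime 131) := ⟨by norm_num⟩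
  natCard_point_eq_of_countPoints 0 1 1 (-2) 0 131 (by norm_num) (by decide +kernel) (n := 130)
    (countPoints_eq_of_fast (by decide +kernel))

/-- `#Ẽ(𝔽₃₉₇) = 374 = 11·34` (`397 ≡ 1`, `a_397 = 24 ≡ 2 (mod 11)`; cyclic `11`-part). [cite: Kim2022StructureSelmer, §1.2.2 (PDF p. 5)] -/
theorem card_397 :
    Nat.card (((⟨0, 1, 1, -2, 0⟩ : WeierstrassCurve ℤ).map (Int.castRingHom (ZMod 397))).toAffine.Point) = 374 :=
  haveI : Fact (Nat.Prime 397) := ⟨by norm_num⟩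
  natCard_point_eq_of_countPoints 0 1 1 (-2) 0 397 (by norm_num) (by decide +kernel) (n := 374)
    (countPoints_eq_of_fast (by decide +kernel))

/-- `#Ẽ(𝔽₉₁₁) = 936 = 13·72` (`911 ≡ 1`, `a_911 = −24 ≡ 2 (mod 13)`; `169 ∤ 936`). [cite: Kim2022StructureSelmer, §1.2.2 (PDF p. 5)] -/
theorem card_911 :
    Nat.card (((⟨0, 1, 1, -2, 0⟩ : WeierstrassCurve ℤ).map (Int.castRingHom (ZMod 911))).toAffine.Point) = 936 :=
  haveI : Fact (Nat.Prime 911) := ⟨by norm_num⟩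
  natCard_point_eq_of_countPoints 0 1 1 (-2) 0 911 (by norm_num) (by decide +kernel) (n := 936)
    (countPoints_eq_of_fast (by decide +kernel))

/-- `#Ẽ(𝔽₉₉₁) = 1045 = 11·95` (`991 ≡ 1`, `a_991 = −53 ≡ 2 (mod 11)`; `121 ∤ 1045`). [cite: Kim2022StructureSelmer, §1.2.2 (PDF p. 5)] -/
theorem card_991 :
    Nat.card (((⟨0, 1, 1, -2, 0⟩ : WeierstrassCurve ℤ).map (Int.castRingHom (ZMod 991))).toAffine.Point) = 1045 :=
  haveI : Fact (Nat.Prime 991) := ⟨by norm_num⟩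
  natCard_point_eq_of_countPoints 0 1 1 (-2) 0 991 (by norm_num) (by decide +kernel) (n := 1045)
    (countPoints_eq_of_fast (by decide +kernel))

/-- `#T̃₀(𝔽₁₁) = 16` (`a_11(T₀) = −4`: non-anomalous at `11`). [cite: SilvermanAEC2009, V.2] -/
theorem minTwist7_card_11 :
    Nat.card (((⟨0, -1, 1, -114, -302⟩ : WeierstrassCurve ℤ).map (Int.castRingHom (ZMod 11))).toAffine.Point) = 16 :=
  haveI : Fact (Nat.Prime 11) := ⟨by norm_num⟩
  natCard_point_eq_of_countPoints 0 (-1) 1 (-114) (-302) 11 (by norm_num) (by decide +kernel) (n := 16)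
    (countPoints_eq_of_fast (by decide +kernel))

/-- `#T̃₀(𝔽₁₃) = 11` (`a_13(T₀) = 3`: non-anomalous at `13`). [cite: SilvermanAEC2009, V.2] -/
theorem minTwist7_card_13 :
    Nat.card (((⟨0, -1, 1, -114, -302⟩ : WeierstrassCurve ℤ).map (Int.castRingHom (ZMod 13))).toAffine.Point) = 11 :=
  haveI : Fact (Nat.Prime 13) := ⟨by norm_num⟩
  natCard_point_eq_of_countPoints 0 (-1) 1 (-114) (-302) 13 (by norm_num) (by decide +kernel) (n := 11)
    (countPoints_eq_of_fast (by decide +kernel))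

/-- `#T̃₀(𝔽₁₉₉) = 198 = 11·18` (`199 ≡ 1`, `a_199(T₀) = 2 ≡ 2 (mod 11)`; cyclic `11`-part). [cite: Kim2022StructureSelmer, §1.2.2 (PDF p. 5)] -/
theorem minTwist7_card_199 :
    Nat.card (((⟨0, -1, 1, -114, -302⟩ : WeierstrassCurve ℤ).map (Int.castRingHom (ZMod 199))).toAffine.Point) = 198 :=
  haveI : Fact (Nat.Prime 199) := ⟨by norm_num⟩
  natCard_point_eq_of_countPoints 0 (-1) 1 (-114) (-302) 199 (by norm_num) (by decide +kernel) (n := 198)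
    (countPoints_eq_of_fast (by decide +kernel))

/-- `#T̃₀(𝔽₉₁₁) = 936 = 13·72` (`911 ≡ 1`, `a_911(T₀) = −24 ≡ 2 (mod 13)`; `169 ∤ 936`). [cite: Kim2022StructureSelmer, §1.2.2 (PDF p. 5)] -/
theorem minTwist7_card_911 :
    Nat.card (((⟨0, -1, 1, -114, -302⟩ : WeierstrassCurve ℤ).map (Int.castRingHom (ZMod 911))).toAffine.Point) = 936 :=
  haveI : Fact (Nat.Prime 911) := ⟨by norm_num⟩
  natCard_point_eq_of_countPoints 0 (-1) 1 (-114) (-302) 911 (by norm_num) (by decide +kernel) (n := 936)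
    (countPoints_eq_of_fast (by decide +kernel))

/-! ## `p = 11`: admissibility and the two cyclic levels -/

/-- **`11` is good ordinary for `389a1`** (`11 ∤ 389`, `a_11 = −4`). [cite: CremonaAlgorithms1997, Table 1 (389a1)] -/
theorem goodOrdinary_11 :
    haveI := Fact.mk (by norm_num : Nat.Prime 11); haveI := curve389a1_isGloballyMinimal;
    Curve389a1.E.HasGoodReductionAtPrime 11 ∧ ¬ ((11 : ℕ) : ℤ) ∣ Curve389a1.E.frobeniusTrace 11 := by
  haveI := Fact.mk (by norm_num : Nat.Prime 11)
  haveI := curve389a1_isGloballyMinimal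
  exact goodOrdinary_of_intModel_certificate intModel 11 (by decide +kernel) (n := 16) AtThree.card_11 (by decide +kernel)

/-- **`ρ̄_{E,11}` is surjective for `389a1`**: semistable and `X² + 5X + 7` (`a_7 = −5`) has no root mod `11`
(Mazur Prop. 6.3 (1) ⟹ irreducible; Serre Prop. 21 ⟹ onto). [cite: Serre1972, §5.4 Prop. 21] [cite: Mazur1978, §6 Prop. 6.3 (1)] -/
theorem hasSurjectiveModNGaloisRep_11 : Curve389a1.E.HasSurjectiveModNGaloisRep (11 : ℕ) := by
  have hn : ∀ t : ZMod 11, t ^ 2 - (((7 : ℕ) : ℤ) + 1 - (13 : ℕ) : ℤ) * t + ((7 : ℕ) : ZMod 11) ≠ 0 := by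
    decide +kernel
  haveI := Fact.mk (by norm_num : Nat.Prime 11)
  haveI := Fact.mk (by norm_num : Nat.Prime 7)
  haveI := curve389a1_isGloballyMinimal
  exact hasSurjectiveModNGaloisRep_of_intModel_certificate intModel
    (by rw [Int.isCoprime_iff_gcd_eq_one]; decide +kernel) 11 7 (by norm_num) (by decide +kernel)
    (n := 13) card_7 hn

/-- **`11` is non-anomalous for `389a1`** (`a_11 − 1 = −5`) and for `T₀` (`a_11(T₀) − 1 = −5`). [cite: SilvermanAEC2009, VII.3 Prop. 3.1] -/
theorem nonAnomalous_11 :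
    haveI := curve389a1_isGloballyMinimal; haveI := minTwist7_isGloballyMinimal; haveI := Fact.mk (by norm_num : Nat.Prime 11);
    ¬ ((11 : ℕ) : ℤ) ∣ Curve389a1.E.frobeniusTrace 11 - 1 ∧
      ¬ ((11 : ℕ) : ℤ) ∣ ((⟨0, -1, 1, -114, -302⟩ : WeierstrassCurve ℤ).map (Int.castRingHom ℚ)).frobeniusTrace 11 - 1 := by
  haveI := curve389a1_isGloballyMinimal
  haveI := minTwist7_isElliptic
  haveI := minTwist7_isGloballyMinimal
  haveI := Fact.mk (by norm_num : Nat.Prime 11)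
  rw [IntModel.frobeniusTrace_eq intModel AtThree.card_11, IntModel.frobeniusTrace_eq minTwist7_intModel minTwist7_card_11]
  decide

/-- **`393427 = 397·991` is a cyclic Kolyvagin level for `(389a1, 11)`** — the level of `cert_389a1` at `p = 11`.
[cite: Kim2022StructureSelmer, §1.2.2 (PDF p. 5)] -/
theorem isCyclicKolyvaginLevel_11_393427 :
    haveI := curve389a1_isGloballyMinimal; haveI := Fact.mk (by norm_num : Nat.Prime 11);
    IsCyclicKolyvaginLevel Curve389a1.E 11 393427 := by
  haveI := curve389a1_isGloballyMinimal
  haveI := Fact.mk (by norm_num : Nat.Prime 11)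
  haveI : Fact (Nat.Prime 397) := ⟨by norm_num⟩
  haveI : Fact (Nat.Prime 991) := ⟨by norm_num⟩
  have h397 : Kato.IsKolyvaginPrime Curve389a1.E 11 1 397 :=
    isKolyvaginPrime_of_intModel_of_card intModel 11 1 397 (by norm_num) (by decide +kernel) (by decide) card_397
      (by norm_num)
  have h991 : Kato.IsKolyvaginPrime Curve389a1.E 11 1 991 :=
    isKolyvaginPrime_of_intModel_of_card intModel 11 1 991 (by norm_num) (by decide +kernel) (by decide) card_991
      (by norm_num)
  refine ⟨by simpa using isKolyvaginProduct_mul h397 h991 (by norm_num), fun ℓ hℓ hdvd ↦ ?_⟩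
  rw [show (393427 : ℕ) = 397 * 991 from rfl] at hdvd
  rcases (Nat.Prime.dvd_mul hℓ.out).mp hdvd with h | h
  · obtain rfl := (Nat.prime_dvd_prime_iff_eq hℓ.out (by norm_num)).mp h
    exact card_torsion_le_of_intModel_of_card intModel 11 397 card_397 (by norm_num)
  · obtain rfl := (Nat.prime_dvd_prime_iff_eq hℓ.out (by norm_num)).mp h
    exact card_torsion_le_of_intModel_of_card intModel 11 991 card_991 (by norm_num)

/-- **`199` is a cyclic Kolyvagin level for `(T₀, 11)`** — the level of `cert_19061a1` at `p = 11`.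
[cite: Kim2022StructureSelmer, §1.2.2 (PDF p. 5)] -/
theorem minTwist7_isCyclicKolyvaginLevel_11_199 :
    haveI := minTwist7_isGloballyMinimal; haveI := Fact.mk (by norm_num : Nat.Prime 11);
    IsCyclicKolyvaginLevel ((⟨0, -1, 1, -114, -302⟩ : WeierstrassCurve ℤ).map (Int.castRingHom ℚ)) 11 199 := by
  haveI := minTwist7_isElliptic
  haveI := minTwist7_isGloballyMinimal
  haveI := Fact.mk (by norm_num : Nat.Prime 11)
  haveI : Fact (Nat.Prime 199) := ⟨by norm_num⟩
  have h199 : Kato.IsKolyvaginPrime ((⟨0, -1, 1, -114, -302⟩ : WeierstrassCurve ℤ).map (Int.castRingHom ℚ)) 11 1 199 :=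
    isKolyvaginPrime_of_intModel_of_card minTwist7_intModel 11 1 199 (by norm_num) (by decide +kernel) (by decide)
      minTwist7_card_199 (by norm_num)
  refine ⟨⟨Nat.squarefree_iff_nodup_primeFactorsList (by norm_num) |>.mpr (by simp), fun ℓ hℓ ↦ ?_⟩, fun ℓ hℓ hdvd ↦ ?_⟩
  · rw [show (199 : ℕ).primeFactors = {199} from (Nat.Prime.primeFactors (by norm_num)), Finset.mem_singleton] at hℓ
    exact hℓ ▸ h199
  · obtain rfl := (Nat.prime_dvd_prime_iff_eq hℓ.out (by norm_num)).mp hdvd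
    exact card_torsion_le_of_intModel_of_card minTwist7_intModel 11 199 minTwist7_card_199 (by norm_num)

/-! ## `p = 13`: admissibility and the two cyclic levels -/

/-- **`13` is good ordinary for `389a1`** (`13 ∤ 389`, `a_13 = −3`). [cite: CremonaAlgorithms1997, Table 1 (389a1)] -/
theorem goodOrdinary_13 :
    haveI := Fact.mk (by norm_num : Nat.Prime 13); haveI := curve389a1_isGloballyMinimal;
    Curve389a1.E.HasGoodReductionAtPrime 13 ∧ ¬ ((13 : ℕ) : ℤ) ∣ Curve389a1.E.frobeniusTrace 13 := by
  haveI := Fact.mk (by norm_num : Nat.Prime 13)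
  haveI := curve389a1_isGloballyMinimal
  exact goodOrdinary_of_intModel_certificate intModel 13 (by decide +kernel) (n := 17) card_13 (by decide +kernel)

/-- **`ρ̄_{E,13}` is surjective for `389a1`**: semistable and `X² + 2X + 3` (`a_3 = −2`) has no root mod `13`.
[cite: Serre1972, §5.4 Prop. 21] [cite: Mazur1978, §6 Prop. 6.3 (1)] -/
theorem hasSurjectiveModNGaloisRep_13 : Curve389a1.E.HasSurjectiveModNGaloisRep (13 : ℕ) := by
  have hn : ∀ t : ZMod 13, t ^ 2 - (((3 : ℕ) : ℤ) + 1 - (6 : ℕ) : ℤ) * t + ((3 : ℕ) : ZMod 13) ≠ 0 := by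
    decide +kernel
  haveI := Fact.mk (by norm_num : Nat.Prime 13)
  haveI := Fact.mk (by norm_num : Nat.Prime 3)
  haveI := curve389a1_isGloballyMinimal
  exact hasSurjectiveModNGaloisRep_of_intModel_certificate intModel
    (by rw [Int.isCoprime_iff_gcd_eq_one]; decide +kernel) 13 3 (by norm_num) (by decide +kernel)
    (n := 6) card_3 hn

/-- **`13` is non-anomalous for `389a1`** (`a_13 − 1 = −4`) and for `T₀` (`a_13(T₀) − 1 = 2`). [cite: SilvermanAEC2009, VII.3 Prop. 3.1] -/
theorem nonAnomalous_13 :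
    haveI := curve389a1_isGloballyMinimal; haveI := minTwist7_isGloballyMinimal; haveI := Fact.mk (by norm_num : Nat.Prime 13);
    ¬ ((13 : ℕ) : ℤ) ∣ Curve389a1.E.frobeniusTrace 13 - 1 ∧
      ¬ ((13 : ℕ) : ℤ) ∣ ((⟨0, -1, 1, -114, -302⟩ : WeierstrassCurve ℤ).map (Int.castRingHom ℚ)).frobeniusTrace 13 - 1 := by
  haveI := curve389a1_isGloballyMinimal
  haveI := minTwist7_isElliptic
  haveI := minTwist7_isGloballyMinimal
  haveI := Fact.mk (by norm_num : Nat.Prime 13)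
  rw [IntModel.frobeniusTrace_eq intModel card_13, IntModel.frobeniusTrace_eq minTwist7_intModel minTwist7_card_13]
  decide

/-- **`119341 = 131·911` is a cyclic Kolyvagin level for `(389a1, 13)`** — the level of `cert_389a1` at `p = 13`.
[cite: Kim2022StructureSelmer, §1.2.2 (PDF p. 5)] -/
theorem isCyclicKolyvaginLevel_13_119341 :
    haveI := curve389a1_isGloballyMinimal; haveI := Fact.mk (by norm_num : Nat.Prime 13);
    IsCyclicKolyvaginLevel Curve389a1.E 13 119341 := by
  haveI := curve389a1_isGloballyMinimal
  haveI := Fact.mk (by norm_num : Nat.Prime 13)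
  haveI : Fact (Nat.Prime 131) := ⟨by norm_num⟩
  haveI : Fact (Nat.Prime 911) := ⟨by norm_num⟩
  have h131 : Kato.IsKolyvaginPrime Curve389a1.E 13 1 131 :=
    isKolyvaginPrime_of_intModel_of_card intModel 13 1 131 (by norm_num) (by decide +kernel) (by decide) card_131
      (by norm_num)
  have h911 : Kato.IsKolyvaginPrime Curve389a1.E 13 1 911 :=
    isKolyvaginPrime_of_intModel_of_card intModel 13 1 911 (by norm_num) (by decide +kernel) (by decide) card_911
      (by norm_num)
  refine ⟨by simpa using isKolyvaginProduct_mul h131 h911 (by norm_num), fun ℓ hℓ hdvd ↦ ?_⟩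
  rw [show (119341 : ℕ) = 131 * 911 from rfl] at hdvd
  rcases (Nat.Prime.dvd_mul hℓ.out).mp hdvd with h | h
  · obtain rfl := (Nat.prime_dvd_prime_iff_eq hℓ.out (by norm_num)).mp h
    exact card_torsion_le_of_intModel_of_card intModel 13 131 card_131 (by norm_num)
  · obtain rfl := (Nat.prime_dvd_prime_iff_eq hℓ.out (by norm_num)).mp h
    exact card_torsion_le_of_intModel_of_card intModel 13 911 card_911 (by norm_num)

/-- **`911` is a cyclic Kolyvagin level for `(T₀, 13)`** — the level of `cert_19061a1` at `p = 13`.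
[cite: Kim2022StructureSelmer, §1.2.2 (PDF p. 5)] -/
theorem minTwist7_isCyclicKolyvaginLevel_13_911 :
    haveI := minTwist7_isGloballyMinimal; haveI := Fact.mk (by norm_num : Nat.Prime 13);
    IsCyclicKolyvaginLevel ((⟨0, -1, 1, -114, -302⟩ : WeierstrassCurve ℤ).map (Int.castRingHom ℚ)) 13 911 := by
  haveI := minTwist7_isElliptic
  haveI := minTwist7_isGloballyMinimal
  haveI := Fact.mk (by norm_num : Nat.Prime 13)
  haveI : Fact (Nat.Prime 911) := ⟨by norm_num⟩
  have h911 : Kato.IsKolyvaginPrime ((⟨0, -1, 1, -114, -302⟩ : WeierstrassCurve ℤ).map (Int.castRingHom ℚ)) 13 1 911 :=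
    isKolyvaginPrime_of_intModel_of_card minTwist7_intModel 13 1 911 (by norm_num) (by decide +kernel) (by decide)
      minTwist7_card_911 (by norm_num)
  refine ⟨⟨Nat.squarefree_iff_nodup_primeFactorsList (by norm_num) |>.mpr (by simp), fun ℓ hℓ ↦ ?_⟩, fun ℓ hℓ hdvd ↦ ?_⟩
  · rw [show (911 : ℕ).primeFactors = {911} from (Nat.Prime.primeFactors (by norm_num)), Finset.mem_singleton] at hℓ
    exact hℓ ▸ h911
  · obtain rfl := (Nat.prime_dvd_prime_iff_eq hℓ.out (by norm_num)).mp hdvd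
    exact card_torsion_le_of_intModel_of_card minTwist7_intModel 13 911 minTwist7_card_911 (by norm_num)

/-! ## The rows at `p = 11` and `p = 13` -/

/-- **DEPTH-TABLE ROW `389a1`, `(p, d_K) = (11, −7)`, v17** — the clause of `KolyvaginDepthSupplyKN` at `389a1` with
witness prime `11` (SPLIT in `ℚ(√−7)`), from the CLAIMS of `cert_389a1` @ `(11, 397·991)` and `cert_19061a1` @ `(11, 199)`,
CONDITIONAL on Kim Thm. 1.11, modularity, Mazur Cor. 4.1, W. Zhang L8.4 (1)/9.1 BY NAME; per curve; BSD is not proved by it.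
[cite: Kim2022StructureSelmer, Thm. 1.11 (PDF p. 8)] [cite: WZhang2014, Lemma 8.4 (1) (p. 236), Thm. 9.1 (p. 240)] [cite: Mazur1978, Cor. 4.1] -/
theorem cruxBody_of_kuriharaClaims_11_neg7
    (hKim : Kim2022_card_selmerGroup_le_pow_of_kuriharaNumber_ne_zero)
    (hnf : exists_isNewformOf) (hMaz : mazur_not_dvd_maninConstant_of_odd)
    (h84 : Literature.NumberTheory.EllipticCurves.WZhang2014_lemma84_exists_minimal_kolyvaginClass_one_selmerCard)
    (K : Type) [Field K] [NumberField K] (hK : IsImaginaryQuadratic K) (hD : NumberField.discr K = -7)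
    (hδE : haveI := curve389a1_isGloballyMinimal; haveI := curve389a1_neZero_conductorNorm;
      haveI := Fact.mk (by norm_num : Nat.Prime 11);
      ∀ (D : ModularParametrizationData Curve389a1.E (Curve389a1.E.conductorNorm ℤ)), ¬ ((11 : ℕ) : ℤ) ∣ D.maninConstant →
        (∃ u : ℚ, ‖(u : ℚ_[11])‖ = 1 ∧ Curve389a1.E.realPeriodRat = u * plusPeriod D.f) →
        ∃ ψ : (ℓ : ℕ) → (ZMod ℓ)ˣ →* Multiplicative (ZMod 11),
          (∀ ℓ ∈ (393427 : ℕ).primeFactors, Function.Surjective (ψ ℓ)) ∧ kuriharaNumber D.f 11 393427 ψ ≠ 0)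
    (hδT : haveI := minTwist7_isElliptic; haveI := minTwist7_isGloballyMinimal;
      haveI : NeZero (((⟨0, -1, 1, -114, -302⟩ : WeierstrassCurve ℤ).map (Int.castRingHom ℚ)).conductorNorm ℤ) :=
        neZero_conductorNorm_of_isElliptic _;
      haveI := Fact.mk (by norm_num : Nat.Prime 11);
      ∀ (D : ModularParametrizationData ((⟨0, -1, 1, -114, -302⟩ : WeierstrassCurve ℤ).map (Int.castRingHom ℚ))
          (((⟨0, -1, 1, -114, -302⟩ : WeierstrassCurve ℤ).map (Int.castRingHom ℚ)).conductorNorm ℤ)),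
        ¬ ((11 : ℕ) : ℤ) ∣ D.maninConstant →
        (∃ u : ℚ, ‖(u : ℚ_[11])‖ = 1 ∧
          ((⟨0, -1, 1, -114, -302⟩ : WeierstrassCurve ℤ).map (Int.castRingHom ℚ)).realPeriodRat = u * plusPeriod D.f) →
        ∃ ψ : (ℓ : ℕ) → (ZMod ℓ)ˣ →* Multiplicative (ZMod 11),
          (∀ ℓ ∈ (199 : ℕ).primeFactors, Function.Surjective (ψ ℓ)) ∧ kuriharaNumber D.f 11 199 ψ ≠ 0) :
    haveI := curve389a1_isGloballyMinimal;
    ∃ (p : ℕ) (hp : Fact p.Prime), 5 ≤ p ∧ Curve389a1.E.HasGoodReductionAtPrime p ∧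
      ¬ (p : ℤ) ∣ Curve389a1.E.frobeniusTrace p ∧ (∀ n : ℕ, Curve389a1.E.HasSurjectiveModNGaloisRep (p ^ n : ℕ)) ∧
      (∀ v : HeightOneSpectrum (𝓞 ℚ), Curve389a1.E.HasMultiplicativeReductionAt v →
        ¬ p ∣ Curve389a1.E.ordMinimalDiscriminant v) ∧
      ∃ (K : Type) (_ : Field K) (_ : NumberField K), IsImaginaryQuadratic K ∧
        NumberField.discr K ≠ -3 ∧ NumberField.discr K ≠ -4 ∧
        ∃ (_ : NeZero (Curve389a1.E.conductorNorm ℤ)), SatisfiesHeegnerHypothesis (Curve389a1.E.conductorNorm ℤ) K ∧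
        ∃ (Dt : ModularParametrizationData Curve389a1.E (Curve389a1.E.conductorNorm ℤ)) (β : ℤ) (ι : K →+* ℂ) (n₁ : ℕ)
          (d : KolyvaginHeegnerData Dt β ι n₁), Squarefree n₁ ∧
          (∀ q ∈ n₁.primeFactors, Zhang2014.IsKolyvaginPrime (Curve389a1.E.conductorNorm ℤ) Curve389a1.E K p q) ∧
          d.kolyvaginClass hp.out 1 ≠ 0 ∧
          (n₁.primeFactors.card + 1 ≤ Curve389a1.E.mordellWeilRank ∨
            (n₁.primeFactors.card ≤ Curve389a1.E.mordellWeilRank ∧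
              n₁.primeFactors.card + 1 ≤ (Curve389a1.E.quadraticTwist (NumberField.discr K : ℚ)).mordellWeilRank)) := by
  haveI := curve389a1_isGloballyMinimal
  haveI iP := Fact.mk (by norm_num : Nat.Prime 11)
  haveI : NeZero (393427 : ℕ) := ⟨by norm_num⟩
  haveI : NeZero (199 : ℕ) := ⟨by norm_num⟩
  have hν : (393427 : ℕ).primeFactors.card ≤ 2 := by
    rw [show (393427 : ℕ) = 397 * 991 from rfl, Nat.primeFactors_mul (by norm_num) (by norm_num),
      Nat.Prime.primeFactors (by norm_num), Nat.Prime.primeFactors (by norm_num)]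
    decide
  have hμ : (199 : ℕ).primeFactors.card ≤ 2 := by
    rw [Nat.Prime.primeFactors (by norm_num), Finset.card_singleton]; omega
  exact cruxBody_of_kuriharaClaims_neg7_at hKim hnf hMaz h84 11 (by norm_num) (by norm_num) goodOrdinary_11.1 goodOrdinary_11.2
    hasSurjectiveModNGaloisRep_11 nonAnomalous_11.1 K hK hD 393427 isCyclicKolyvaginLevel_11_393427 hν hδE
    nonAnomalous_11.2 199 minTwist7_isCyclicKolyvaginLevel_11_199 hμ hδT

/-- **DEPTH-TABLE ROW `389a1`, `(p, d_K) = (13, −7)`, v17** — the clause of `KolyvaginDepthSupplyKN` at `389a1` with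
witness prime `13` (INERT in `ℚ(√−7)`), from the CLAIMS of `cert_389a1` @ `(13, 131·911)` and `cert_19061a1` @ `(13, 911)`,
CONDITIONAL on Kim Thm. 1.11, modularity, Mazur Cor. 4.1, W. Zhang L8.4 (1)/9.1 BY NAME; per curve; BSD is not proved by it.
[cite: Kim2022StructureSelmer, Thm. 1.11 (PDF p. 8)] [cite: WZhang2014, Lemma 8.4 (1) (p. 236), Thm. 9.1 (p. 240)] [cite: Mazur1978, Cor. 4.1] -/
theorem cruxBody_of_kuriharaClaims_13_neg7
    (hKim : Kim2022_card_selmerGroup_le_pow_of_kuriharaNumber_ne_zero)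
    (hnf : exists_isNewformOf) (hMaz : mazur_not_dvd_maninConstant_of_odd)
    (h84 : Literature.NumberTheory.EllipticCurves.WZhang2014_lemma84_exists_minimal_kolyvaginClass_one_selmerCard)
    (K : Type) [Field K] [NumberField K] (hK : IsImaginaryQuadratic K) (hD : NumberField.discr K = -7)
    (hδE : haveI := curve389a1_isGloballyMinimal; haveI := curve389a1_neZero_conductorNorm;
      haveI := Fact.mk (by norm_num : Nat.Prime 13);
      ∀ (D : ModularParametrizationData Curve389a1.E (Curve389a1.E.conductorNorm ℤ)), ¬ ((13 : ℕ) : ℤ) ∣ D.maninConstant →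
        (∃ u : ℚ, ‖(u : ℚ_[13])‖ = 1 ∧ Curve389a1.E.realPeriodRat = u * plusPeriod D.f) →
        ∃ ψ : (ℓ : ℕ) → (ZMod ℓ)ˣ →* Multiplicative (ZMod 13),
          (∀ ℓ ∈ (119341 : ℕ).primeFactors, Function.Surjective (ψ ℓ)) ∧ kuriharaNumber D.f 13 119341 ψ ≠ 0)
    (hδT : haveI := minTwist7_isElliptic; haveI := minTwist7_isGloballyMinimal;
      haveI : NeZero (((⟨0, -1, 1, -114, -302⟩ : WeierstrassCurve ℤ).map (Int.castRingHom ℚ)).conductorNorm ℤ) :=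
        neZero_conductorNorm_of_isElliptic _;
      haveI := Fact.mk (by norm_num : Nat.Prime 13);
      ∀ (D : ModularParametrizationData ((⟨0, -1, 1, -114, -302⟩ : WeierstrassCurve ℤ).map (Int.castRingHom ℚ))
          (((⟨0, -1, 1, -114, -302⟩ : WeierstrassCurve ℤ).map (Int.castRingHom ℚ)).conductorNorm ℤ)),
        ¬ ((13 : ℕ) : ℤ) ∣ D.maninConstant →
        (∃ u : ℚ, ‖(u : ℚ_[13])‖ = 1 ∧
          ((⟨0, -1, 1, -114, -302⟩ : WeierstrassCurve ℤ).map (Int.castRingHom ℚ)).realPeriodRat = u * plusPeriod D.f) →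
        ∃ ψ : (ℓ : ℕ) → (ZMod ℓ)ˣ →* Multiplicative (ZMod 13),
          (∀ ℓ ∈ (911 : ℕ).primeFactors, Function.Surjective (ψ ℓ)) ∧ kuriharaNumber D.f 13 911 ψ ≠ 0) :
    haveI := curve389a1_isGloballyMinimal;
    ∃ (p : ℕ) (hp : Fact p.Prime), 5 ≤ p ∧ Curve389a1.E.HasGoodReductionAtPrime p ∧
      ¬ (p : ℤ) ∣ Curve389a1.E.frobeniusTrace p ∧ (∀ n : ℕ, Curve389a1.E.HasSurjectiveModNGaloisRep (p ^ n : ℕ)) ∧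
      (∀ v : HeightOneSpectrum (𝓞 ℚ), Curve389a1.E.HasMultiplicativeReductionAt v →
        ¬ p ∣ Curve389a1.E.ordMinimalDiscriminant v) ∧
      ∃ (K : Type) (_ : Field K) (_ : NumberField K), IsImaginaryQuadratic K ∧
        NumberField.discr K ≠ -3 ∧ NumberField.discr K ≠ -4 ∧
        ∃ (_ : NeZero (Curve389a1.E.conductorNorm ℤ)), SatisfiesHeegnerHypothesis (Curve389a1.E.conductorNorm ℤ) K ∧
        ∃ (Dt : ModularParametrizationData Curve389a1.E (Curve389a1.E.conductorNorm ℤ)) (β : ℤ) (ι : K →+* ℂ) (n₁ : ℕ)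
          (d : KolyvaginHeegnerData Dt β ι n₁), Squarefree n₁ ∧
          (∀ q ∈ n₁.primeFactors, Zhang2014.IsKolyvaginPrime (Curve389a1.E.conductorNorm ℤ) Curve389a1.E K p q) ∧
          d.kolyvaginClass hp.out 1 ≠ 0 ∧
          (n₁.primeFactors.card + 1 ≤ Curve389a1.E.mordellWeilRank ∨
            (n₁.primeFactors.card ≤ Curve389a1.E.mordellWeilRank ∧
              n₁.primeFactors.card + 1 ≤ (Curve389a1.E.quadraticTwist (NumberField.discr K : ℚ)).mordellWeilRank)) := by
  haveI := curve389a1_isGloballyMinimal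
  haveI iP := Fact.mk (by norm_num : Nat.Prime 13)
  haveI : NeZero (119341 : ℕ) := ⟨by norm_num⟩
  haveI : NeZero (911 : ℕ) := ⟨by norm_num⟩
  have hν : (119341 : ℕ).primeFactors.card ≤ 2 := by
    rw [show (119341 : ℕ) = 131 * 911 from rfl, Nat.primeFactors_mul (by norm_num) (by norm_num),
      Nat.Prime.primeFactors (by norm_num), Nat.Prime.primeFactors (by norm_num)]
    decide
  have hμ : (911 : ℕ).primeFactors.card ≤ 2 := by
    rw [Nat.Prime.primeFactors (by norm_num), Finset.card_singleton]; omega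
  exact cruxBody_of_kuriharaClaims_neg7_at hKim hnf hMaz h84 13 (by norm_num) (by norm_num) goodOrdinary_13.1 goodOrdinary_13.2
    hasSurjectiveModNGaloisRep_13 nonAnomalous_13.1 K hK hD 119341 isCyclicKolyvaginLevel_13_119341 hν hδE
    nonAnomalous_13.2 911 minTwist7_isCyclicKolyvaginLevel_13_911 hμ hδT

end C389a1

end Summit.BirchSwinnertonDyer.BirchSwinnertonDyer.Theorems.KolyvaginDepthDoor

end
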